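import Summits.QuantumFields.YangMills.Theorems.BalabanUVNodesN15TwoSpacingGluingCurvedKnitCovariantLandau
import HarnessLib

/-!
# Route «BalabanUVNodes», node N15 = NE2, road (c) — PROGRAMME (P-R), XIII: THE COVARIANT LANDAU TERM `D_U(I − R(U))D*_U` DOES NOT DEPEND ON THE AVERAGING MASS `a`
# (and neither does the perturbation letter `N_V^R`) — `R(U)` projects onto `Δ^U N(Q′)`, a space free of `a` (dag-n15-c g22, n15-c∕210)

Cell `pub-ymgap`, seat `pub-ymgap-dag-n15-c` (generation g22; R134 (a), s1; HUMAN RULING D-0062; chair R424 venue).  `bears_on: R4∕N15 · K3⁸ SpineGivenEndpointR13SepCoPHV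
(stmt-QuantumFields-27366)`; filed `--supports stmt-QuantumFields-27366 --as helper` — COUNT-NEUTRAL.  Finite linear algebra ([folklore]); no `def`; 0 `sorry`; NO estimate.
Imports BY NAME n15-c∕201 `…TwoSpacingGluingCurvedKnitCovariantLandau` (`cvT₀`, `cvLandau`, `cvNVr`) and through it n15-c∕199 (`claplA_mul_cGreen`, `cGreen_mul_claplA`, `cR_transpose`,
`csavg_cGreen_mul_cR`, `cR_mulVec_of_mem_ker`), n15-c∕197 (the objects), n15-a `coordMat_mulLeftRight_inv_mul`.  Nothing in the tree is modified.

WHY.  [B9] p. 394: *«R = R(U) is an orthogonal projection … onto the subspace ℛ = Δ^η_U N(Q′)»* ((3.21)) — a space in whose description the averaging mass `a` of `Δ′_a = Δ_U + aQ′*Q′`,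
`G′ = (Δ′_a)⁻¹` ((3.25)) does not occur, although the FORMULA (3.25) for `R` is written with `G′ = G′_a`.  n15-c∕199 typed (3.21) in the MODEL of n15-c∕197: `R(U) = cR` is the symmetric
idempotent with range `ker(Q′G′_a)`.  THIS FILE draws the consequence the letters programme needs: `ker(Q′G′_a) = {Δ′_aw : Q′w = 0} = {D*_UD_Uw : Q′w = 0}` is the same space for every
`a > 0`, so `R(U)`, `I − R(U)` and the Landau term `D_U(I − R(U))D*_U` — hence the cover's `cvLandau` and the perturbation letter `N_V^R = cvNVr` of n15-c∕201 — are the SAME matrices for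
all `a, a′ > 0`.  Use: every consumer (n15-c∕202–207) may run at any `a > 0` (they do: `ha : 0 < a` is their only mass hypothesis), while an estimate of the Landau letters may be carried out
at the mass of its choice — e.g. `a = a′·n^{d+1}`, at which n15-c∕200 `lapAFlat_eq_reM` identifies the model's `Δ′_a` with the `n`-uniformly coercive `DeltaPs n M a′` of the T⁴ swarm
(`Support∕ScalarAveragedPropagator`, `Support∕ScalarCovariantCoercive.coercive_scalarOp`) — without changing the object estimated.  The flat special case is n15-c∕200 `piFlat_eq`
(`piFlat M n a = reM PcT + reM Pker` for every `a > 0`).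

RESULTS ([folklore]; tags mark the printed sentence each theorem transcribes in the model — nothing printed is asserted as an estimate).
* §1 `csavg_cGreen_mulVec_eq_zero_of` (`Q′G′_a v = 0 ⇒ Q′G′_{a′} v = 0`), `csavg_cGreen_mulVec_eq_zero_iff`, `cR_mul_cR_of_mass` (`R_a R_{a′} = R_{a′}`), ★ `cR_eq_of_mass` (`R_a = R_{a′}`),
  `cPi_eq_of_mass`, ★★ `landauCov_eq_of_mass` (`D_U(I − R_a(U))D*_U = D_U(I − R_{a′}(U))D*_U`).
* §2 `isUnit_cvT₀` (the site datum of a unitary bond field is invertible), ★ `cvLandau_eq_of_mass`, ★★ `cvNVr_eq_of_mass` (the cover's Landau term and the letter `N_V^R` at unitary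
  `U` are free of `a`).

HONEST FRAMING ∕ LIMITS.  MODEL objects of n15-c∕197∕201 (whole torus, one averaging level, uniform weights in `Δ′_a`, one-level staircases, site∕component-blind colour transports);
typing of a structural remark, NOT an estimate; the Landau LETTERS (the six rows of n15-c∕206∕207's `hR`) remain NOT proved; NOT [B9] Thms 3.1–3.4 as printed; NE2⁺ NOT PRINTED;
N15 of record untouched (DISCHARGED AS CONSUMED p687738); counts UNMOVED (typed 28∕28 · discharged 8∕27); one finite torus — nothing continuum ∕ OS ∕ mass gap ∕ Clay.
Restate-immune (no Theses import).
-/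

noncomputable section

open scoped BigOperators Matrix

/-! ## §1 `R(U)`, `I − R(U)` and `D_U(I − R(U))D*_U` are free of the averaging mass -/

namespace Summit.QuantumFields.YangMills.BalabanUVNodes.N15.CovLandau

open Literature.MathematicalPhysics.QuantumFieldTheory.Balaban1983to89
open Literature.MathematicalPhysics.QuantumFieldTheory.Balaban1983to89.B5Prop11Plancherel (Tor fine)

variable {d : ℕ} (M : Fin (d + 1) → ℕ) [∀ μ, NeZero (M μ)] (n : ℕ) [NeZero n] {ι : Type} [Fintype ι] [DecidableEq ι]

section Mass

/-- `Q′G′_a v = 0 ⇒ Q′G′_{a′} v = 0`: with `w := G′_a v` one has `Q′w = 0`, so `v = Δ′_a w = D*Dw = Δ′_{a′} w` and `G′_{a′} v = w`. [cite: Balaban1985BackgroundPropagators, (3.21) p.394 («ℛ = Δ^η_U N(Q′)»: shape)] -/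
theorem csavg_cGreen_mulVec_eq_zero_of {T : Fin (d + 1) → Tor (fine n M) → Matrix ι ι ℝ} (hT : ∀ ν x, IsUnit (T ν x)) {a a' : ℝ} (ha : 0 < a) (ha' : 0 < a')
    {v : Tor (fine n M) × ι → ℝ} (hv : csavg M n T *ᵥ (cGreen M n T a *ᵥ v) = 0) : csavg M n T *ᵥ (cGreen M n T a' *ᵥ v) = 0 := by
  set w := cGreen M n T a *ᵥ v with hw
  have hv' : v = claplA M n T a *ᵥ w := by rw [hw, Matrix.mulVec_mulVec, claplA_mul_cGreen M n hT ha, Matrix.one_mulVec]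
  have hΔ : claplA M n T a' *ᵥ w = v := by
    rw [hv', claplA, claplA, Matrix.add_mulVec, Matrix.add_mulVec, Matrix.smul_mulVec, Matrix.smul_mulVec, ← Matrix.mulVec_mulVec w (csavg M n T)ᵀ,
      hv, Matrix.mulVec_zero, smul_zero, smul_zero]
  rw [← hΔ, Matrix.mulVec_mulVec w (cGreen M n T a'), cGreen_mul_claplA M n hT ha', Matrix.one_mulVec, hv]

/-- `ker(Q′G′_a) = ker(Q′G′_{a′})`. [cite: Balaban1985BackgroundPropagators, (3.21) p.394 (shape)] -/
theorem csavg_cGreen_mulVec_eq_zero_iff {T : Fin (d + 1) → Tor (fine n M) → Matrix ι ι ℝ} (hT : ∀ ν x, IsUnit (T ν x)) {a a' : ℝ} (ha : 0 < a) (ha' : 0 < a')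
    (v : Tor (fine n M) × ι → ℝ) : csavg M n T *ᵥ (cGreen M n T a *ᵥ v) = 0 ↔ csavg M n T *ᵥ (cGreen M n T a' *ᵥ v) = 0 :=
  ⟨csavg_cGreen_mulVec_eq_zero_of M n hT ha ha', csavg_cGreen_mulVec_eq_zero_of M n hT ha' ha⟩

/-- `R_a · R_{a′} = R_{a′}`: the range of `R_{a′}` lies in `ker(Q′G′_{a′}) = ker(Q′G′_a)`, which `R_a` fixes. [cite: Balaban1985BackgroundPropagators, (3.21), (3.25) p.394 (shape)] -/
theorem cR_mul_cR_of_mass {T : Fin (d + 1) → Tor (fine n M) → Matrix ι ι ℝ} (hT : ∀ ν x, IsUnit (T ν x)) {a a' : ℝ} (ha : 0 < a) (ha' : 0 < a') :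
    cR M n T a * cR M n T a' = cR M n T a' := by
  refine Matrix.toLin'.injective (LinearMap.ext fun v => ?_)
  rw [Matrix.toLin'_mul, LinearMap.comp_apply, Matrix.toLin'_apply, Matrix.toLin'_apply]
  refine cR_mulVec_of_mem_ker M n T a (csavg_cGreen_mulVec_eq_zero_of M n hT ha' ha ?_)
  have h := congrArg (fun X => X *ᵥ v) (csavg_cGreen_mul_cR M n hT ha')
  simpa only [← Matrix.mulVec_mulVec, Matrix.zero_mulVec] using h

/-- ★ **`R(U)` IS FREE OF THE AVERAGING MASS**: `R_a(U) = R_{a′}(U)` for all `a, a′ > 0` (two symmetric matrices `A`, `B` with `AB = B`, `BA = A` coincide: `A = (BA)ᵀ = AᵀBᵀ = AB = B`).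
[cite: Balaban1985BackgroundPropagators, (3.21) p.394 («orthogonal projection onto ℛ = Δ^η_U N(Q′)»)] -/
theorem cR_eq_of_mass {T : Fin (d + 1) → Tor (fine n M) → Matrix ι ι ℝ} (hT : ∀ ν x, IsUnit (T ν x)) {a a' : ℝ} (ha : 0 < a) (ha' : 0 < a') :
    cR M n T a = cR M n T a' := by
  have h1 := cR_mul_cR_of_mass M n hT ha ha'
  have h2 := cR_mul_cR_of_mass M n hT ha' ha
  calc cR M n T a = (cR M n T a' * cR M n T a)ᵀ := by rw [h2, cR_transpose]
    _ = cR M n T a * cR M n T a' := by rw [Matrix.transpose_mul, cR_transpose, cR_transpose]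
    _ = cR M n T a' := h1

/-- `I − R(U)` is free of the averaging mass. [cite: Balaban1985BackgroundPropagators, (3.25) p.394 (shape)] -/
theorem cPi_eq_of_mass {T : Fin (d + 1) → Tor (fine n M) → Matrix ι ι ℝ} (hT : ∀ ν x, IsUnit (T ν x)) {a a' : ℝ} (ha : 0 < a) (ha' : 0 < a') :
    cPi M n T a = cPi M n T a' := by
  have h := cR_eq_of_mass M n hT ha ha'
  rw [cR, cR] at h
  exact sub_right_injective h

/-- ★★ **THE COVARIANT LANDAU TERM IS FREE OF THE AVERAGING MASS**: `D_U(I − R_a(U))D*_U = D_U(I − R_{a′}(U))D*_U` for all `a, a′ > 0` and every field of invertible transports.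
[cite: Balaban1985BackgroundPropagators, (3.26) p.395 (shape), (3.21) p.394] -/
theorem landauCov_eq_of_mass {T : Fin (d + 1) → Tor (fine n M) → Matrix ι ι ℝ} (hT : ∀ ν x, IsUnit (T ν x)) {a a' : ℝ} (ha : 0 < a) (ha' : 0 < a') :
    landauCov M n T a = landauCov M n T a' := by
  rw [landauCov, landauCov, cPi_eq_of_mass M n hT ha ha']

end Mass

end Summit.QuantumFields.YangMills.BalabanUVNodes.N15.CovLandau

/-! ## §2 On the cover: `cvLandau` and the letter `N_V^R = cvNVr` at a unitary bond field are free of the averaging mass -/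

namespace Summit.QuantumFields.YangMills.BalabanUVNodes.N15.Gluing

open Literature.MathematicalPhysics.QuantumFieldTheory.Balaban1983to89
open Literature.MathematicalPhysics.QuantumFieldTheory.Balaban1983to89.B5Prop11Plancherel (Tor fine)
open Summit.QuantumFields.YangMills.BalabanUVNodes.N15.MatrixSpecies (coordMat)
open Summit.QuantumFields.YangMills.BalabanUVNodes.N15.CurvedSpecies (coordMat_mulLeftRight_inv_mul)
open Summit.QuantumFields.YangMills.BalabanUVNodes.N15.CovLandau (landauCov landauCov_eq_of_mass)

variable {d : ℕ}

section CoverMass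

open scoped Matrix.Norms.L2Operator

variable {mm : Type} [Fintype mm] [DecidableEq mm] {ι : Type} [Fintype ι] [DecidableEq ι] {L : ℕ} [NeZero L]

/-- The site datum of a UNITARY bond field is a field of invertible colour matrices (`coordMat e Ad_{Uᴴ}` is a left inverse of `coordMat e Ad_U`).
[cite: Balaban1985BackgroundPropagators, (3.23) p.394 (shape)] -/
theorem isUnit_cvT₀ {M : Fin (d + 1) → ℕ} [∀ μ, NeZero (M μ)] {n : ℕ} [NeZero n] (e : Matrix mm mm ℂ ≃L[ℝ] (ι → ℝ)) {U : Fin (d + 1) → Tor (fine n M) × Fin (d + 1) → Matrix mm mm ℂ}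
    (hU : ∀ ν p, (U ν p)ᴴ * U ν p = 1) (ν : Fin (d + 1)) (x : Tor (fine n M)) : IsUnit (cvT₀ e U ν x) :=
  (Matrix.isUnit_iff_isUnit_det _).mpr (Matrix.isUnit_det_of_left_inverse (coordMat_mulLeftRight_inv_mul e (hU ν (x, ν))))

variable (d) (L : ℕ) [NeZero L]

/-- ★ The cover's covariant Landau term at a unitary bond field is free of the averaging mass. [cite: Balaban1985BackgroundPropagators, (3.26) p.395 (shape), (3.21) p.394] -/
theorem cvLandau_eq_of_mass (mv kk : ℕ) (hL : Odd L ∧ 1 < L) {a a' : ℝ} (ha : 0 < a) (ha' : 0 < a') (e : Matrix mm mm ℂ ≃L[ℝ] (ι → ℝ))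
    {U : Fin (d + 1) → CvX d L mv kk hL → Matrix mm mm ℂ} (hU : ∀ ν p, (U ν p)ᴴ * U ν p = 1) :
    cvLandau d L mv kk hL a ι e U = cvLandau d L mv kk hL a' ι e U := by
  rw [cvLandau, cvLandau, landauCov_eq_of_mass _ _ (isUnit_cvT₀ e hU) ha ha']

/-- ★★ **THE LANDAU PERTURBATION LETTER `N_V^R` AT A UNITARY BOND FIELD IS FREE OF THE AVERAGING MASS** — the object whose six localisation rows n15-c∕206∕207 display may be estimated at
any convenient `a > 0`. [cite: Balaban1985BackgroundPropagators, (3.26) p.395 (shape), (3.21) p.394; Balaban1984PropagatorsI, (1.69) p.29] -/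
theorem cvNVr_eq_of_mass (mv kk : ℕ) (hL : Odd L ∧ 1 < L) {a a' : ℝ} (ha : 0 < a) (ha' : 0 < a') (e : Matrix mm mm ℂ ≃L[ℝ] (ι → ℝ))
    {U : Fin (d + 1) → CvX d L mv kk hL → Matrix mm mm ℂ} (hU : ∀ ν p, (U ν p)ᴴ * U ν p = 1) :
    cvNVr d L mv kk hL a ι e U = cvNVr d L mv kk hL a' ι e U := by
  rw [cvNVr, cvNVr, cvLandau_eq_of_mass d L mv kk hL ha ha' e hU]

end CoverMass

end Summit.QuantumFields.YangMills.BalabanUVNodes.N15.Gluing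

end
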